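import Literature.MathematicalPhysics.QuantumFieldTheory.Balaban1983to89.B9CubeSequence408
import Literature.MathematicalPhysics.QuantumFieldTheory.Balaban1983to89.B6Prop23MultiLevelTorusL0

/-!
# `Balaban1983to89.B9Thm31CubeLocalFlat` — [B9] THEOREMS 3.1 AND 3.2 AT `U = 1` FOR THE CUBE-LOCAL LETTERS `G′_□`, `C_□` OF SECT. C
# (p. 409: «The operators constructed for this sequence … satisfy all the inequalities of Theorems 3.1–3.3»): the four sup entries
# (3.42) of `G′_□(1)` and the kernel bound (3.48) of `C_□(1) = (Q′G′_□²Q′*)⁻¹`, with ONE set of constants for every member and every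
# cube — BY NAME from the `…L0` lineage at the cube family of `B9CubeSequence408` (sub-row G-B9-LETTERS, module M5.1a, file 2)

FRAMING (verbatim cell line):
statement-level skeleton of published theorems with citation tags; proofs where landed; nothing here is a claim about the Yang–Mills mass gap

Sources under audit (cell lit-balaban): T. Bałaban, *Propagators for lattice gauge theories in a background field*, Commun.
Math. Phys. **99** (1985) 389–434 [`Balaban1985BackgroundPropagators`, "B9"], Thm 3.1 (3.42) p. 397, Thm 3.2 (3.48) p. 398, Cor.
3.5 p. 407 («we can use the results of [4]. There we have proved these theorems for operators with the external gauge field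
configuration U = 1»), Sect. C pp. 408–409; T. Bałaban, *Propagators and renormalization transformations for lattice gauge
theories. II*, Commun. Math. Phys. **96** (1984) 223–250 [`Balaban1984PropagatorsII`, "[4]"], Prop. 2.2 (2.67) p. 234, Prop. 2.3
(2.87) p. 238.  Unit `lit-balaban-r05` (r05 gen 77; G-B9-LETTERS M5.1a, map `lit-balaban-r06/B9-LETTERS-MAP.md` v1 §4); B9 fold
owner r06, B6 fold owner r03, referee ref-4.

## WHAT IS PRINTED (verbatim up to notation)

[B9] p. 409 l. 1–5: «the sequence {Ω_n(□)} satisfies the assumptions of Corollary 3.6. The operators constructed for this sequence,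
which we denote by G′_□(U), C_□(U) = (Q′(U)G′_□²(U)Q′*(U))⁻¹, G_□(U), satisfy all the inequalities of Theorems 3.1–3.3
correspondingly. This is the basis of all estimates for the expansions we will construct.»  Thm 3.1 (3.42) p. 397: «|(G′(U)λ)(x)|,
|(∇_UG′(U)λ)(x)|, |(G′(U)∇*_Uλ)(x)|, |(Δ_UG′(U)λ)(x)| ≦ B₀[(L^jη)², L^jη, L^jη, 1]e^{−δ₀d(y,y′)}|λ| for x ∈ Δ(y), y ∈ Λ_j,
supp λ ⊂ Δ(y′)».  Thm 3.2 (3.48) p. 398: «|(Q′(U)G′²(U)Q′*(U))⁻¹(y, y′)| ≦ B₀(L^jη)⁻⁴(L^{j′}η)^{−d}e^{−δ₀d(y,y′)}».  p. 407: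
at U = 1 these are [4] Prop. 2.2 (2.67) and Prop. 2.3 (2.87).

## WHAT THIS FILE CERTIFIES (kernel-checked; lattice units `η = 1`; setting of `B9CubeSequence408`)

For every member `D : B6MultiLevelTorusOperator.TDomains d ℓ M_h k P R` (odd `L = ℓ + 1 ≥ 2`, odd `M_h ≥ 1`, `R ≥ 2L`, `P ≥ 4`) and
every cover cube `q ∈ cubes D.toDomains`, with the cube family `cubeFam D q …` of file 1 and print's weights `a_{j+1} = aPrinted L 1`:
* §1 **THE CUBE LETTERS AT `U = 1`**: `GpCube … = (toKTIdx …).G = gmlT(cubeFam)` (= `G′_□(1) = Δ′_{a,□}⁻¹`) and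
  `CinvCube … = B6Prop23MultiLevelTorusL0.GinvT (cubeFam …) a` (= `C_□(1)`);
* §2 **`thm31_cube_flat_supEntries`** = THEOREM 3.1 (3.42) AT `U = 1` FOR `G′_□`: there are `M₁, δ₀, C > 0` (functions of `d, L`
  ONLY) such that for EVERY member with `M₁ ≤ M = L·M_h` and EVERY cube, the four sup entries `e_m` of the census reading
  (`(toKTIdx …).gp.e m λ y` = `sup_{x∈B(y)}` of `|G′_□λ|`, `|∇_μG′_□λ|`, `|G′_□∇*_μλ|`, `|ΔG′_□λ|`) obey
  `e_m ≤ C·[len(y)², len(y), len(y), 1]_m·e^{−(δ₀/2)d(y,y′)}·|λ|` for `supp λ ⊂ B(y′)` — p33's `prop22_supEntries_kLevelTorus` at the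
  index `toKTIdx D q …` of ALL level-0 torus families;
* §3 **`thm32_cube_flat`** = THEOREM 3.2 (3.48) AT `U = 1` FOR `C_□`: there are `δ₁, C, M₀ > 0` (functions of `d, L`) such that for
  every member with `M₀ ≤ M` and every cube, `C_□(1)` is THE two-sided inverse of the (2.87) operator `Q′G′_□²Q′*` of the cube family
  and `|C_□(y,y′)/W(y′)| ≤ C·len(y)^{−4}·len(y′)^{−(d+1)}·e^{−(δ₁/2)d(y,y′)}` — `B6Prop23MultiLevelTorusL0.prop23_multiLevelTorus` at
  `cubeFam` with the printed weight windows (`B6Prop22KLevelCensusL0.KIdx.aPrinted_windows`).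

## v1.1 (r05 gen 77, same day) — §4–§7 AT THE def-Y-COMPATIBLE WEIGHTS `wCube`

The [4]-operator `Δ′_{a,□}` of the cube sequence must AGREE ROW-WISE with the member's `Δ′_a` near `□`: (3.88) p. 409 uses
`Δ′_a G′_□ h_□ λ = h_□ λ + …` on `supp h_□`, i.e. the rows of `Δ′_a` and `Δ′_{a,□}` at `supp h_□` coincide.  In def-Y's currency
(`Node00.OpsYDeltaPrimeA.deltaPrimeAY`, weights `aPrinted L 1 j` at a level `j ≥ 1`, census `B6Prop22KLevelTorusCensus.KTIdx.G`)
this forces the cube operator's weight at a level `j ≥ 1` to be `a_j = aPrinted L 1 j` — NOT the `…L0` census's `a_{j+1}` of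
§1–§3 (which stay: a legitimate [4]-operator of the cube family, landed API, but not the object of (3.87)–(3.90)).  The floor
(level `0`, the exterior of the cube sequence under ruling (R)) carries `a = 1` («(Q′₀λ)(x) = λ(x)», no renormalisation step
taken), and the recursion (2.14) then holds from `j = 0` with the cube parameter `c₀ = (1 − L⁻²)⁻¹` (`c_j = 1` for `j ≥ 1`):
* §4 `wCube L j := aPrinted L 1 (max j 1)`, `cCube`; windows `1 − L⁻² ≤ wCube ≤ 1`, `1 ≤ cCube ≤ (1 − L⁻²)⁻¹`, the recursion
  `wCube (j+1) = aNext L (wCube j) (cCube j)` for ALL `j` (`wCube_rec`), `wCube_of_one_le : 1 ≤ j → wCube L j = aPrinted L 1 j`;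
* §5 `GpCubeW … := gmlT … (cubeFam …).lev (wCube L)` (= `G′_□(1)`), the inverse laws `mlOpT … (wCube L) * GpCubeW = 1` and
  `GpCubeW * mlOpT … = 1` (`B6MultiLevelTorusOperator.mlOpT_mul_gmlT ∕ gmlT_mul_mlOpT`), `CinvCubeW := GinvT (cubeFam …) (wCube L)`;
* §6 **THEOREM 3.1 (3.42) AT `U = 1` FOR `G′_□` AT THESE WEIGHTS, IN BLOCK-MAJORANT FORM** (`B6RandomWalk.HasMajorant` over the cube
  family's geometry `geomT (cubeFam …)`, the form def-Y's (2.51) ⇄ (3.42) dictionary `Node00.OpsYRead342` consumes): the four entries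
  `G′_□`, `∂_μG′_□`, `G′_□∂_μ*`, `(−Δ^{per})G′_□` majorised by `C·[L^{2j}, L^j, L^j, 1]·e^{−(δ₀/2)d(y,y′)}` — the `…L0` majorants
  `prop22_first ∕ second ∕ third ∕ sixth_multiLevelTorus` (general weights `a, c` in windows + recursion) at `(cubeFam, wCube, cCube)`;
* §7 **THEOREM 3.2 (3.48) AT `U = 1` FOR `C_□` AT THESE WEIGHTS** (`thm32_cubeW_flat`, as §3 with `wCube ∕ cCube`).

v1.2 (same gen; DOCSTRINGS ONLY, code byte-identical to v1.1 p595058): `wCube`'s docstring cites [B9] (3.24) p. 394 «a_1 = a_0 = a > 0» — the floor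
weight `a₀ = a` is PRINT's, not a modelling choice (r06 PAGE CHECK u.458 (1)).

## HONEST SCOPE

* `U = 1`; the cube family of file 1 (single scale, mass-`a₀` exterior — its HONEST SCOPE applies verbatim); the geometry, lengths
  `len`, distance `d` and blocks are the CUBE FAMILY's (they agree with the member's on the hull of □, file 1 `lev_cubeFam_eq_of_InH`).
* This file certifies the sup block (3.42) and (3.48) only; the Hölder entries (3.43)–(3.45), the L² entries (3.46), the global
  entries (3.47), (3.49) and Thm 3.3 (the vector `G_□`) for the cube family are the next files of M5.1a (all by name from the `…L0`
  lineage: `B6Prop22Holder/DualHolderMultiLevelTorusL0`, `B9Ineq346/347*`, `B9Ineq349MultiLevelTorusL0`, `B6Cor28EntriesKLevelV1L0`).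
* The reading into def-Y's `kernelFamilySInv` (p21's `B9CubeLettersInvReadings`) waits for the general-U cube letters over a
  level-0 index (statement list v1 FINDING 4); nothing here fakes a `SiteOpY`.
* Nothing is inferred from the manuscript: every step is kernel-checked (two instantiations).  NOT summit progress; the YM mass gap is
  not proved by any of this (Track A conditional rung).
-/

namespace Literature.MathematicalPhysics.QuantumFieldTheory.Balaban1983to89.B9Thm31CubeLocalFlat

open Literature.MathematicalPhysics.QuantumFieldTheory.Balaban1983to89.B4Reflection242 (boxDom)
open Literature.MathematicalPhysics.QuantumFieldTheory.Balaban1983to89.B6MultiLevelBoxOperator (N0 aPrinted aPrinted_one aPrinted_window aPrinted_succ)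
open Literature.MathematicalPhysics.QuantumFieldTheory.Balaban1983to89.B6Ineq243TwoLevelBox (aNext)
open Literature.MathematicalPhysics.QuantumFieldTheory.Balaban1983to89.B6MultiLevelTorusOperator (gmlT mlOpT perLapT one_le_N0 mlOpT_mul_gmlT gmlT_mul_mlOpT)
open Literature.MathematicalPhysics.QuantumFieldTheory.Balaban1983to89.B6Cover236MultiLevelBlocks (cubes)
open Literature.MathematicalPhysics.QuantumFieldTheory.Balaban1983to89.B6Prop22KLevelTorusCensusL0 (KTIdx prop22_supEntries_kLevelTorus)
open Literature.MathematicalPhysics.QuantumFieldTheory.Balaban1983to89.B6Geom246MultiLevelBoxL0 (bset)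
open Literature.MathematicalPhysics.QuantumFieldTheory.Balaban1983to89.B6Geom246MultiLevelTorusL0 (geomT)
open Literature.MathematicalPhysics.QuantumFieldTheory.Balaban1983to89.B6Ineq268MultiLevelBoxL0 (W)
open Literature.MathematicalPhysics.QuantumFieldTheory.Balaban1983to89.B6Expansion282 (kerOp)
open Literature.MathematicalPhysics.QuantumFieldTheory.Balaban1983to89.B6Prop23Chain (mat)
open Literature.MathematicalPhysics.QuantumFieldTheory.Balaban1983to89.B8Ineq192MultiLevelTorusL0 (XkT)
open Literature.MathematicalPhysics.QuantumFieldTheory.Balaban1983to89.B6Prop23MultiLevelTorusL0 (GinvT prop23_multiLevelTorus)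
open Literature.MathematicalPhysics.QuantumFieldTheory.Balaban1983to89.B6Prop22MultiLevelTorusL0 (prop22_first_multiLevelTorus)
open Literature.MathematicalPhysics.QuantumFieldTheory.Balaban1983to89.B6Prop22DerivMultiLevelTorusL0 (prop22_second_multiLevelTorus)
open Literature.MathematicalPhysics.QuantumFieldTheory.Balaban1983to89.B6Prop22AdjMultiLevelTorusL0 (prop22_third_multiLevelTorus)
open Literature.MathematicalPhysics.QuantumFieldTheory.Balaban1983to89.B6Prop22LapMultiLevelTorusL0 (prop22_sixth_multiLevelTorus)
open Literature.MathematicalPhysics.QuantumFieldTheory.Balaban1983to89.B6Prop22DerivMultiLevelTorus (dT)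
open Literature.MathematicalPhysics.QuantumFieldTheory.Balaban1983to89.B6Geom246MultiLevelBoxL0 (blkOf)
open Literature.MathematicalPhysics.QuantumFieldTheory.Balaban1983to89.B6RandomWalk (HasMajorant)
open Literature.MathematicalPhysics.QuantumFieldTheory.Balaban1983to89.B9CubeSequence408 (cubeFam toKTIdx)
open Literature.MathematicalPhysics.QuantumFieldTheory.Balaban1983to89.B9 (pref4)

variable {d ℓ Mh k R : ℕ} {P : Fin (d + 1) → ℕ}

/-! ## §1 The cube letters at `U = 1` -/

/-- **`G′_□(1)`** — the [4]-operator `Δ′_{a,□}⁻¹ = gmlT` of the cube family with print's weights `a = 1` (the census letter `G` at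
the cube index). [cite: Balaban1985BackgroundPropagators, p.409 («G′_□(U)»); Balaban1984PropagatorsII, p.225 («G′ = Δ′_a^{−1}»)] -/
noncomputable def GpCube (D : B6MultiLevelTorusOperator.TDomains d ℓ Mh k P R) (q : ↥(cubes D.toDomains))
    (hL : Odd (ℓ + 1)) (hM : Odd Mh) (hk : 1 ≤ k) (hMh : 1 ≤ Mh) (hR : 2 * (ℓ + 1) ≤ R) (hP4 : ∀ μ, 4 ≤ P μ) :
    Matrix ↥(boxDom (N0 ℓ Mh k P)) ↥(boxDom (N0 ℓ Mh k P)) ℝ :=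
  (toKTIdx D q hL hM hk hMh hR hP4).G

/-- `G′_□(1)` unfolded: the torus inverse `gmlT` of the cube family's level function with the weights `aPrinted L 1 (j+1)`.
[cite: Balaban1984PropagatorsII, (2.13)–(2.14) p.225, dictionary] -/
theorem GpCube_eq (D : B6MultiLevelTorusOperator.TDomains d ℓ Mh k P R) (q : ↥(cubes D.toDomains))
    (hL : Odd (ℓ + 1)) (hM : Odd Mh) (hk : 1 ≤ k) (hMh : 1 ≤ Mh) (hR : 2 * (ℓ + 1) ≤ R) (hP4 : ∀ μ, 4 ≤ P μ) :
    GpCube D q hL hM hk hMh hR hP4 =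
      gmlT (N0 ℓ Mh k P) ℓ k (cubeFam D q hL hM hMh (fun μ => le_trans (by norm_num) (hP4 μ))).lev
        (fun j => aPrinted ℓ 1 (j + 1)) := rfl

/-- **`C_□(1) = (Q′G′_□²Q′*)⁻¹`** — the (2.87) inverse of the cube family (the `…L0` lineage's `GinvT`), print's weights.
[cite: Balaban1985BackgroundPropagators, p.409 («C_□(U) = (Q′(U)G′_□²(U)Q′*(U))⁻¹»); Balaban1984PropagatorsII, Prop. 2.3 (2.87) p.238] -/
noncomputable def CinvCube (D : B6MultiLevelTorusOperator.TDomains d ℓ Mh k P R) (q : ↥(cubes D.toDomains))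
    (hL : Odd (ℓ + 1)) (hM : Odd Mh) (hMh : 1 ≤ Mh) (hP : ∀ μ, 1 ≤ P μ) :
    Module.End ℝ (↥(bset (cubeFam D q hL hM hMh hP).toDomains) → ℝ) :=
  GinvT (cubeFam D q hL hM hMh hP) (fun j => aPrinted ℓ 1 (j + 1))

/-! ## §2 Theorem 3.1 (3.42) at `U = 1` for `G′_□` -/

/-- **THEOREM 3.1 (3.42) AT `U = 1` FOR THE CUBE-LOCAL `G′_□` OF EVERY COVER CUBE OF EVERY MEMBER** (constants `M₁, δ₀, C` depend on
`d, L` only): the census `prop22_supEntries_kLevelTorus` of all level-0 torus families at the index `toKTIdx D q …`.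
[cite: Balaban1985BackgroundPropagators, Thm 3.1 (3.42) p.397 with Cor. 3.5 p.407 and p.409 l.1–5; Balaban1984PropagatorsII, Prop. 2.2 (2.67) p.234] -/
theorem thm31_cube_flat_supEntries (d ℓ : ℕ) (hℓ : 1 ≤ ℓ) :
    ∃ M₁ δ₀ C : ℝ, 0 < M₁ ∧ 0 < δ₀ ∧ 0 < C ∧
      ∀ {Mh k R : ℕ} {P : Fin (d + 1) → ℕ} (D : B6MultiLevelTorusOperator.TDomains d ℓ Mh k P R)
        (q : ↥(cubes D.toDomains)) (hL : Odd (ℓ + 1)) (hM : Odd Mh) (hk : 1 ≤ k) (hMh : 1 ≤ Mh)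
        (hR : 2 * (ℓ + 1) ≤ R) (hP4 : ∀ μ, 4 ≤ P μ), M₁ ≤ ((ℓ : ℝ) + 1) * Mh →
        ∀ (m : Fin 4) (lam : (toKTIdx D q hL hM hk hMh hR hP4).geoT.Loc)
          (y y' : (toKTIdx D q hL hM hk hMh hR hP4).geoT.Site),
          (toKTIdx D q hL hM hk hMh hR hP4).geoT.suppIn lam y' →
          (toKTIdx D q hL hM hk hMh hR hP4).gp.e m lam y ≤
            C * pref4 ((toKTIdx D q hL hM hk hMh hR hP4).geoT.len y) m *
              Real.exp (-(δ₀ / 2 * (toKTIdx D q hL hM hk hMh hR hP4).geoT.dist y y')) *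
              (toKTIdx D q hL hM hk hMh hR hP4).geoT.supNorm lam := by
  obtain ⟨M₁, δ₀, C, hM₁, hδ₀, hC, h⟩ := prop22_supEntries_kLevelTorus d ℓ hℓ
  exact ⟨M₁, δ₀, C, hM₁, hδ₀, hC, fun D q hL hM hk hMh hR hP4 hMle m lam y y' hs =>
    h (toKTIdx D q hL hM hk hMh hR hP4) trivial hMle m lam y y' hs⟩

/-! ## §3 Theorem 3.2 (3.48) at `U = 1` for `C_□` -/

/-- **THEOREM 3.2 (3.48) AT `U = 1` FOR THE CUBE-LOCAL `C_□ = (Q′G′_□²Q′*)⁻¹` OF EVERY COVER CUBE OF EVERY MEMBER** (constants `δ₁, C,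
M₀` depend on `d, L` only): `C_□(1)` is the two-sided inverse of the (2.87) operator of the cube family, the unique left inverse, and its
kernel obeys `|C_□(y, y′)/W(y′)| ≤ C·len(y)^{−4}·len(y′)^{−(d+1)}·e^{−(δ₁/2)d(y,y′)}` — `prop23_multiLevelTorus` at the cube family with
the printed weight windows. [cite: Balaban1985BackgroundPropagators, Thm 3.2 (3.48) p.398 with Cor. 3.5 p.407 and p.409 l.1–5; Balaban1984PropagatorsII, Prop. 2.3 (2.87) p.238] -/
theorem thm32_cube_flat (d ℓ : ℕ) (hℓ : 1 ≤ ℓ) :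
    ∃ δ₁ C M₀ : ℝ, 0 < δ₁ ∧ 0 < C ∧ 0 < M₀ ∧
      ∀ {Mh k R : ℕ} {P : Fin (d + 1) → ℕ} (D : B6MultiLevelTorusOperator.TDomains d ℓ Mh k P R)
        (q : ↥(cubes D.toDomains)) (hL : Odd (ℓ + 1)) (hM : Odd Mh) (hMh : 1 ≤ Mh) (hP : ∀ μ, 1 ≤ P μ)
        (_hP4 : ∀ μ, 4 ≤ P μ) (_hR : 2 * (ℓ + 1) ≤ R), M₀ ≤ ((ℓ : ℝ) + 1) * Mh →
        CinvCube D q hL hM hMh hP *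
            kerOp (W (cubeFam D q hL hM hMh hP).toDomains) (XkT (cubeFam D q hL hM hMh hP) (fun j => aPrinted ℓ 1 (j + 1))) = 1 ∧
        kerOp (W (cubeFam D q hL hM hMh hP).toDomains) (XkT (cubeFam D q hL hM hMh hP) (fun j => aPrinted ℓ 1 (j + 1))) *
            CinvCube D q hL hM hMh hP = 1 ∧
        (∀ G' : Module.End ℝ (↥(bset (cubeFam D q hL hM hMh hP).toDomains) → ℝ),
          G' * kerOp (W (cubeFam D q hL hM hMh hP).toDomains)
            (XkT (cubeFam D q hL hM hMh hP) (fun j => aPrinted ℓ 1 (j + 1))) = 1 → G' = CinvCube D q hL hM hMh hP) ∧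
        ∀ y y' : ↥(bset (cubeFam D q hL hM hMh hP).toDomains),
          |mat (CinvCube D q hL hM hMh hP) y y' / W (cubeFam D q hL hM hMh hP).toDomains y'| ≤
            C * (geomT (cubeFam D q hL hM hMh hP)).len y ^ (-(4 : ℝ)) *
              (geomT (cubeFam D q hL hM hMh hP)).len y' ^ (-((d + 1 : ℕ) : ℝ)) *
              Real.exp (-(δ₁ / 2 * (geomT (cubeFam D q hL hM hMh hP)).dist y y')) := by
  -- the printed weight windows: `1 − L⁻² ≤ a_{j+1} ≤ 1`, `c_j = 1`, recursion (2.14)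
  have hL2 : (1 : ℝ) < (((ℓ : ℝ) + 1)) ^ 2 := by
    have : (2 : ℝ) ≤ (ℓ : ℝ) + 1 := by
      have : (1 : ℝ) ≤ ℓ := by exact_mod_cast hℓ
      linarith
    nlinarith
  have hamin : 0 < 1 - ((((ℓ : ℝ) + 1)) ^ 2)⁻¹ := by rw [sub_pos]; exact inv_lt_one_of_one_lt₀ hL2
  obtain ⟨hwin, hrec⟩ := B6Prop22KLevelCensusL0.KIdx.aPrinted_windows hℓ
  obtain ⟨δ₁, C, M₀, hδ₁, hC, hM₀, h⟩ :=
    prop23_multiLevelTorus d ℓ hℓ (1 - ((((ℓ : ℝ) + 1)) ^ 2)⁻¹) 1 1 1 hamin one_pos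
  refine ⟨δ₁, C, M₀, hδ₁, hC, hM₀, ?_⟩
  intro Mh k R P D q hL hM hMh hP hP4 hR hMle
  exact h k Mh R hMle hR P hP hP4 (cubeFam D q hL hM hMh hP) (fun j => aPrinted ℓ 1 (j + 1)) (fun _ => 1)
    hwin (fun _ => ⟨le_rfl, le_rfl⟩) hrec

/-! ## §4 The def-Y-compatible weights of the cube operator (v1.1) -/

section Weights

variable (ℓ)

/-- **the weights of the cube operator `Δ′_{a,□}`**: `a₀ = a = 1` on the floor (level `0`, «(Q′₀λ)(x) = λ(x)»; [B9] (3.24) p. 394 prints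
«a_1 = a_0 = a > 0»), print's `a_j = aPrinted L 1 j` at a level `j ≥ 1` — the member's weights (def-Y's `Node00.avgCoeffY`), so that `Δ′_{a,□}` and
`Δ′_a` have the same rows near `□`; i.e. `wCube` IS print's sequence `(a_j)_{j ≥ 0}` of (3.24) at `a = 1`.
[cite: Balaban1985BackgroundPropagators, (3.24) p.394 («a_{j+1} = aa_j/(aL⁻² + a_j), a_1 = a_0 = a > 0»), (3.88) p.409; Balaban1984PropagatorsII, (2.14) p.225] -/
noncomputable def wCube : ℕ → ℝ := fun j => aPrinted ℓ 1 (max j 1)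

/-- the cube parameters closing the recursion (2.14) from `j = 0`: `c₀ = (1 − L⁻²)⁻¹`, `c_j = 1` for `j ≥ 1` (a bookkeeping device of the
`…L0` majorants, which quantify over weights `a, c` in windows with `a_{j+1} = aNext L a_j c_j`). [cite: Balaban1984PropagatorsII, (2.14) p.225, dictionary] -/
noncomputable def cCube : ℕ → ℝ := fun j => if j = 0 then (1 - ((((ℓ : ℝ) + 1)) ^ 2)⁻¹)⁻¹ else 1

variable {ℓ}

/-- at a level `j ≥ 1` the cube weight IS print's `a_j`. [cite: Balaban1984PropagatorsII, (2.14) p.225] -/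
theorem wCube_of_one_le {j : ℕ} (hj : 1 ≤ j) : wCube ℓ j = aPrinted ℓ 1 j := by
  unfold wCube; rw [max_eq_left hj]

/-- `wCube (j+1) = a_{j+1}`. [cite: Balaban1984PropagatorsII, (2.14) p.225, bookkeeping] -/
theorem wCube_succ (j : ℕ) : wCube ℓ (j + 1) = aPrinted ℓ 1 (j + 1) := wCube_of_one_le (Nat.succ_le_succ (Nat.zero_le j))

/-- the floor carries `a₁ = a = 1`. [cite: Balaban1984PropagatorsII, (2.14) p.225 («a₁ = a», «(Q′₀λ)(x) = λ(x)»)] -/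
theorem wCube_zero (hℓ : 1 ≤ ℓ) : wCube ℓ 0 = 1 := by
  unfold wCube; rw [Nat.max_eq_right (Nat.zero_le 1)]; exact aPrinted_one hℓ 1

/-- `1 < L²`. [cite: Balaban1984PropagatorsII, (2.1) p.224, bookkeeping] -/
theorem one_lt_L_sq (hℓ : 1 ≤ ℓ) : (1 : ℝ) < (((ℓ : ℝ) + 1)) ^ 2 := by
  have h1 : (1 : ℝ) ≤ ℓ := by exact_mod_cast hℓ
  nlinarith

/-- `0 < 1 − L⁻²`. [cite: Balaban1984PropagatorsII, (2.14) p.225, bookkeeping] -/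
theorem amin_pos (hℓ : 1 ≤ ℓ) : (0 : ℝ) < 1 - ((((ℓ : ℝ) + 1)) ^ 2)⁻¹ := by
  rw [sub_pos]; exact inv_lt_one_of_one_lt₀ (one_lt_L_sq hℓ)

/-- the window `1 − L⁻² ≤ wCube L j ≤ 1` (all `j`). [cite: Balaban1984PropagatorsII, (2.14) p.225] -/
theorem wCube_window (hℓ : 1 ≤ ℓ) (j : ℕ) :
    1 - ((((ℓ : ℝ) + 1)) ^ 2)⁻¹ ≤ wCube ℓ j ∧ wCube ℓ j ≤ 1 := by
  obtain ⟨h1, h2, _⟩ := aPrinted_window hℓ one_pos (le_max_right j 1)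
  exact ⟨by rw [one_mul] at h1; exact h1, h2⟩

/-- the cube weights are positive. [cite: Balaban1984PropagatorsII, (2.14) p.225] -/
theorem wCube_pos (hℓ : 1 ≤ ℓ) (j : ℕ) : 0 < wCube ℓ j := (aPrinted_window hℓ one_pos (le_max_right j 1)).2.2

/-- the window `1 ≤ cCube L j ≤ (1 − L⁻²)⁻¹`. [cite: Balaban1984PropagatorsII, (2.14) p.225, bookkeeping] -/
theorem cCube_window (hℓ : 1 ≤ ℓ) (j : ℕ) :
    1 ≤ cCube ℓ j ∧ cCube ℓ j ≤ (1 - ((((ℓ : ℝ) + 1)) ^ 2)⁻¹)⁻¹ := by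
  have hamin := amin_pos hℓ
  have hle1 : 1 - ((((ℓ : ℝ) + 1)) ^ 2)⁻¹ ≤ 1 := by
    have : (0 : ℝ) ≤ ((((ℓ : ℝ) + 1)) ^ 2)⁻¹ := by positivity
    linarith
  have hc0 : (1 : ℝ) ≤ (1 - ((((ℓ : ℝ) + 1)) ^ 2)⁻¹)⁻¹ := (one_le_inv₀ hamin).2 hle1
  unfold cCube
  split_ifs
  · exact ⟨hc0, le_rfl⟩
  · exact ⟨le_rfl, hc0⟩

/-- **the recursion (2.14) holds from `j = 0`**: `wCube (j+1) = aNext L (wCube j) (cCube j)` — at `j = 0` by the choice of `c₀`, at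
`j ≥ 1` it is print's `a_{j+1} = aa_j/(aL^{−2} + a_j)` (`aPrinted_succ`). [cite: Balaban1984PropagatorsII, (2.14) p.225] -/
theorem wCube_rec (hℓ : 1 ≤ ℓ) (j : ℕ) : wCube ℓ (j + 1) = aNext ℓ (wCube ℓ j) (cCube ℓ j) := by
  rcases Nat.eq_zero_or_pos j with hj | hj
  · subst hj
    rw [wCube_zero hℓ, wCube_succ, aPrinted_one hℓ 1]
    unfold cCube aNext
    rw [if_pos rfl]
    have hamin := amin_pos hℓ
    have hr0 : (0 : ℝ) < ((((ℓ : ℝ) + 1)) ^ 2)⁻¹ := by positivity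
    generalize ((((ℓ : ℝ) + 1)) ^ 2)⁻¹ = r at hamin hr0 ⊢
    have h1 : (1 - r)⁻¹ * r + 1 = (1 - r)⁻¹ := by
      field_simp
      ring
    rw [mul_one, h1, div_self (inv_ne_zero hamin.ne')]
  · rw [wCube_of_one_le hj, wCube_succ, aPrinted_succ hℓ one_pos hj]
    unfold cCube
    rw [if_neg (Nat.pos_iff_ne_zero.1 hj)]

end Weights

/-! ## §5 The cube letters at `U = 1` at the def-Y-compatible weights -/

/-- **`G′_□(1)` AT THE def-Y-COMPATIBLE WEIGHTS** — `gmlT` of the cube family's level function with the weights `wCube L`.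
[cite: Balaban1985BackgroundPropagators, p.409 («G′_□(U)»), p.395 («coincides with Δ_a … if U = 1»); Balaban1984PropagatorsII, p.225 («G′ = Δ′_a^{−1}»)] -/
noncomputable def GpCubeW (D : B6MultiLevelTorusOperator.TDomains d ℓ Mh k P R) (q : ↥(cubes D.toDomains))
    (hL : Odd (ℓ + 1)) (hM : Odd Mh) (hMh : 1 ≤ Mh) (hP : ∀ μ, 1 ≤ P μ) :
    Matrix ↥(boxDom (N0 ℓ Mh k P)) ↥(boxDom (N0 ℓ Mh k P)) ℝ :=
  gmlT (N0 ℓ Mh k P) ℓ k (cubeFam D q hL hM hMh hP).lev (wCube ℓ)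

/-- `Δ′_{a,□}·G′_□(1) = 1`. [cite: Balaban1984PropagatorsII, p.225 («G′ = Δ′_a^{−1} is a well defined, positive operator»)] -/
theorem mlOpT_mul_GpCubeW (hℓ : 1 ≤ ℓ) (D : B6MultiLevelTorusOperator.TDomains d ℓ Mh k P R) (q : ↥(cubes D.toDomains))
    (hL : Odd (ℓ + 1)) (hM : Odd Mh) (hMh : 1 ≤ Mh) (hP : ∀ μ, 1 ≤ P μ) :
    mlOpT (N0 ℓ Mh k P) ℓ k (cubeFam D q hL hM hMh hP).lev (wCube ℓ) * GpCubeW D q hL hM hMh hP = 1 :=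
  mlOpT_mul_gmlT (one_le_N0 hMh hP) (cubeFam D q hL hM hMh hP).lev_le (wCube_pos hℓ)

/-- `G′_□(1)·Δ′_{a,□} = 1`. [cite: Balaban1984PropagatorsII, p.225 («G′ = Δ′_a^{−1}»)] -/
theorem GpCubeW_mul_mlOpT (hℓ : 1 ≤ ℓ) (D : B6MultiLevelTorusOperator.TDomains d ℓ Mh k P R) (q : ↥(cubes D.toDomains))
    (hL : Odd (ℓ + 1)) (hM : Odd Mh) (hMh : 1 ≤ Mh) (hP : ∀ μ, 1 ≤ P μ) :
    GpCubeW D q hL hM hMh hP * mlOpT (N0 ℓ Mh k P) ℓ k (cubeFam D q hL hM hMh hP).lev (wCube ℓ) = 1 :=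
  gmlT_mul_mlOpT (one_le_N0 hMh hP) (cubeFam D q hL hM hMh hP).lev_le (wCube_pos hℓ)

/-- **`C_□(1) = (Q′G′_□²Q′*)⁻¹` AT THE def-Y-COMPATIBLE WEIGHTS** — the (2.87) inverse of the cube family at `wCube L`.
[cite: Balaban1985BackgroundPropagators, p.409 («C_□(U) = (Q′(U)G′_□²(U)Q′*(U))⁻¹»); Balaban1984PropagatorsII, Prop. 2.3 (2.87) p.238] -/
noncomputable def CinvCubeW (D : B6MultiLevelTorusOperator.TDomains d ℓ Mh k P R) (q : ↥(cubes D.toDomains))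
    (hL : Odd (ℓ + 1)) (hM : Odd Mh) (hMh : 1 ≤ Mh) (hP : ∀ μ, 1 ≤ P μ) :
    Module.End ℝ (↥(bset (cubeFam D q hL hM hMh hP).toDomains) → ℝ) :=
  GinvT (cubeFam D q hL hM hMh hP) (wCube ℓ)

/-! ## §6 Theorem 3.1 (3.42) at `U = 1` for `G′_□` at the def-Y-compatible weights, block-majorant form -/

/-- **(3.42)₁ AT `U = 1` FOR `G′_□`** (weights `wCube`): `G′_□(1)` has the block majorant `C·L^{2j}·e^{−(δ₀/2)d(y,y′)}` over the cube
family's geometry — `prop22_first_multiLevelTorus` at `(cubeFam, wCube, cCube)`; constants depend on `d, L` only.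
[cite: Balaban1985BackgroundPropagators, Thm 3.1 (3.42) p.397 (first entry) with Cor. 3.5 p.407 and p.409 l.1–5; Balaban1984PropagatorsII, Prop. 2.2 (2.67)₁ p.234, (2.51) p.232] -/
theorem thm31_cubeW_flat_first (d ℓ : ℕ) (hℓ : 1 ≤ ℓ) :
    ∃ δ₀ C M₀ : ℝ, ∃ N₀ : ℕ, 0 < δ₀ ∧ 0 < C ∧ 0 < M₀ ∧ 0 < N₀ ∧
      ∀ {Mh k R : ℕ} {P : Fin (d + 1) → ℕ} (D : B6MultiLevelTorusOperator.TDomains d ℓ Mh k P R)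
        (q : ↥(cubes D.toDomains)) (hL : Odd (ℓ + 1)) (hM : Odd Mh) (hMh : 1 ≤ Mh) (hP : ∀ μ, 1 ≤ P μ),
        3 ≤ Mh → M₀ ≤ ((ℓ : ℝ) + 1) * Mh → 2 * (ℓ + 1) ≤ R → N₀ + 1 ≤ R * ((ℓ + 1) * Mh) → (∀ μ, 4 ≤ P μ) →
        HasMajorant (g := geomT (cubeFam D q hL hM hMh hP)) (blkOf (cubeFam D q hL hM hMh hP).toDomains)
          (Matrix.toLin' (GpCubeW D q hL hM hMh hP))
          (fun y y' => C * ((ℓ : ℝ) + 1) ^ (2 * y.1.1) *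
            Real.exp (-(δ₀ / 2 * (geomT (cubeFam D q hL hM hMh hP)).dist y y'))) := by
  obtain ⟨δ₀, C, M₀, N₀, hδ₀, hC, hM₀, hN₀, h⟩ :=
    prop22_first_multiLevelTorus d ℓ hℓ (1 - ((((ℓ : ℝ) + 1)) ^ 2)⁻¹) 1 1 (1 - ((((ℓ : ℝ) + 1)) ^ 2)⁻¹)⁻¹ (amin_pos hℓ) one_pos
  refine ⟨δ₀, C, M₀, N₀, hδ₀, hC, hM₀, hN₀, ?_⟩
  intro Mh k R P D q hL hM hMh hP h3 hM0 hR hN0 hP4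
  exact h k Mh R h3 hM0 hR hN0 P hP hP4 (cubeFam D q hL hM hMh hP) (wCube ℓ) (cCube ℓ) (wCube_window hℓ) (cCube_window hℓ)
    (wCube_rec hℓ)

/-- **(3.42)₂ AT `U = 1` FOR `G′_□`** (weights `wCube`): every forward difference `∂_μG′_□(1)` has the block majorant `C·L^{j}·e^{−(δ₀/2)d(y,y′)}`
— `prop22_second_multiLevelTorus` at `(cubeFam, wCube, cCube)`.
[cite: Balaban1985BackgroundPropagators, Thm 3.1 (3.42) p.397 (second entry) with Cor. 3.5 p.407 and p.409 l.1–5; Balaban1984PropagatorsII, Prop. 2.2 (2.67)₂ p.234] -/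
theorem thm31_cubeW_flat_second (d ℓ : ℕ) (hℓ : 1 ≤ ℓ) :
    ∃ δ₀ C M₀ : ℝ, ∃ N₀ : ℕ, 0 < δ₀ ∧ 0 < C ∧ 0 < M₀ ∧ 0 < N₀ ∧
      ∀ {Mh k R : ℕ} {P : Fin (d + 1) → ℕ} (D : B6MultiLevelTorusOperator.TDomains d ℓ Mh k P R)
        (q : ↥(cubes D.toDomains)) (hL : Odd (ℓ + 1)) (hM : Odd Mh) (hMh : 1 ≤ Mh) (hP : ∀ μ, 1 ≤ P μ),
        3 ≤ Mh → M₀ ≤ ((ℓ : ℝ) + 1) * Mh → 2 * (ℓ + 1) ≤ R → N₀ + 1 ≤ R * ((ℓ + 1) * Mh) → (∀ μ, 4 ≤ P μ) →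
        ∀ μ : Fin (d + 1),
        HasMajorant (g := geomT (cubeFam D q hL hM hMh hP)) (blkOf (cubeFam D q hL hM hMh hP).toDomains)
          (Matrix.toLin' (dT (N0 ℓ Mh k P) μ * GpCubeW D q hL hM hMh hP))
          (fun y y' => C * ((ℓ : ℝ) + 1) ^ y.1.1 *
            Real.exp (-(δ₀ / 2 * (geomT (cubeFam D q hL hM hMh hP)).dist y y'))) := by
  obtain ⟨δ₀, C, M₀, N₀, hδ₀, hC, hM₀, hN₀, h⟩ :=
    prop22_second_multiLevelTorus d ℓ hℓ (1 - ((((ℓ : ℝ) + 1)) ^ 2)⁻¹) 1 1 (1 - ((((ℓ : ℝ) + 1)) ^ 2)⁻¹)⁻¹ (amin_pos hℓ) one_pos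
  refine ⟨δ₀, C, M₀, N₀, hδ₀, hC, hM₀, hN₀, ?_⟩
  intro Mh k R P D q hL hM hMh hP h3 hM0 hR hN0 hP4
  exact h k Mh R h3 hM0 hR hN0 P hP hP4 (cubeFam D q hL hM hMh hP) (wCube ℓ) (cCube ℓ) (wCube_window hℓ) (cCube_window hℓ)
    (wCube_rec hℓ)

/-- **(3.42)₃ AT `U = 1` FOR `G′_□`** (weights `wCube`): every `G′_□(1)∂_μ*` has the block majorant `C·L^{j}·e^{−(δ₀/2)d(y,y′)}` —
`prop22_third_multiLevelTorus` at `(cubeFam, wCube, cCube)`.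
[cite: Balaban1985BackgroundPropagators, Thm 3.1 (3.42) p.397 (third entry) with Cor. 3.5 p.407 and p.409 l.1–5; Balaban1984PropagatorsII, Prop. 2.2 (2.67)₃ p.234] -/
theorem thm31_cubeW_flat_third (d ℓ : ℕ) (hℓ : 1 ≤ ℓ) :
    ∃ δ₀ C M₀ : ℝ, ∃ N₀ : ℕ, 0 < δ₀ ∧ 0 < C ∧ 0 < M₀ ∧ 0 < N₀ ∧
      ∀ {Mh k R : ℕ} {P : Fin (d + 1) → ℕ} (D : B6MultiLevelTorusOperator.TDomains d ℓ Mh k P R)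
        (q : ↥(cubes D.toDomains)) (hL : Odd (ℓ + 1)) (hM : Odd Mh) (hMh : 1 ≤ Mh) (hP : ∀ μ, 1 ≤ P μ),
        3 ≤ Mh → M₀ ≤ ((ℓ : ℝ) + 1) * Mh → 2 * (ℓ + 1) ≤ R → N₀ + 1 ≤ R * ((ℓ + 1) * Mh) → (∀ μ, 4 ≤ P μ) →
        ∀ μ : Fin (d + 1),
        HasMajorant (g := geomT (cubeFam D q hL hM hMh hP)) (blkOf (cubeFam D q hL hM hMh hP).toDomains)
          (Matrix.toLin' (GpCubeW D q hL hM hMh hP * (dT (N0 ℓ Mh k P) μ).transpose))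
          (fun y y' => C * ((ℓ : ℝ) + 1) ^ y.1.1 *
            Real.exp (-(δ₀ / 2 * (geomT (cubeFam D q hL hM hMh hP)).dist y y'))) := by
  obtain ⟨δ₀, C, M₀, N₀, hδ₀, hC, hM₀, hN₀, h⟩ :=
    prop22_third_multiLevelTorus d ℓ hℓ (1 - ((((ℓ : ℝ) + 1)) ^ 2)⁻¹) 1 1 (1 - ((((ℓ : ℝ) + 1)) ^ 2)⁻¹)⁻¹ (amin_pos hℓ) one_pos
  refine ⟨δ₀, C, M₀, N₀, hδ₀, hC, hM₀, hN₀, ?_⟩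
  intro Mh k R P D q hL hM hMh hP h3 hM0 hR hN0 hP4
  exact h k Mh R h3 hM0 hR hN0 P hP hP4 (cubeFam D q hL hM hMh hP) (wCube ℓ) (cCube ℓ) (wCube_window hℓ) (cCube_window hℓ)
    (wCube_rec hℓ)

/-- **(3.42)₄ AT `U = 1` FOR `G′_□`** (weights `wCube`): `(−Δ^{per})G′_□(1)` has the block majorant `C·e^{−(δ₀/2)d(y,y′)}` —
`prop22_sixth_multiLevelTorus` at `(cubeFam, wCube, cCube)`.
[cite: Balaban1985BackgroundPropagators, Thm 3.1 (3.42) p.397 (fourth entry) with Cor. 3.5 p.407 and p.409 l.1–5; Balaban1984PropagatorsII, Prop. 2.2 (2.67)₆ p.234] -/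
theorem thm31_cubeW_flat_sixth (d ℓ : ℕ) (hℓ : 1 ≤ ℓ) :
    ∃ δ₀ C M₀ : ℝ, ∃ N₀ : ℕ, 0 < δ₀ ∧ 0 < C ∧ 0 < M₀ ∧ 0 < N₀ ∧
      ∀ {Mh k R : ℕ} {P : Fin (d + 1) → ℕ} (D : B6MultiLevelTorusOperator.TDomains d ℓ Mh k P R)
        (q : ↥(cubes D.toDomains)) (hL : Odd (ℓ + 1)) (hM : Odd Mh) (hMh : 1 ≤ Mh) (hP : ∀ μ, 1 ≤ P μ),
        3 ≤ Mh → M₀ ≤ ((ℓ : ℝ) + 1) * Mh → 2 * (ℓ + 1) ≤ R → N₀ + 1 ≤ R * ((ℓ + 1) * Mh) → (∀ μ, 4 ≤ P μ) →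
        HasMajorant (g := geomT (cubeFam D q hL hM hMh hP)) (blkOf (cubeFam D q hL hM hMh hP).toDomains)
          (Matrix.toLin' (perLapT (N0 ℓ Mh k P) * GpCubeW D q hL hM hMh hP))
          (fun y y' => C * Real.exp (-(δ₀ / 2 * (geomT (cubeFam D q hL hM hMh hP)).dist y y'))) := by
  obtain ⟨δ₀, C, M₀, N₀, hδ₀, hC, hM₀, hN₀, h⟩ :=
    prop22_sixth_multiLevelTorus d ℓ hℓ (1 - ((((ℓ : ℝ) + 1)) ^ 2)⁻¹) 1 1 (1 - ((((ℓ : ℝ) + 1)) ^ 2)⁻¹)⁻¹ (amin_pos hℓ) one_pos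
  refine ⟨δ₀, C, M₀, N₀, hδ₀, hC, hM₀, hN₀, ?_⟩
  intro Mh k R P D q hL hM hMh hP h3 hM0 hR hN0 hP4
  exact h k Mh R h3 hM0 hR hN0 P hP hP4 (cubeFam D q hL hM hMh hP) (wCube ℓ) (cCube ℓ) (wCube_window hℓ) (cCube_window hℓ)
    (wCube_rec hℓ)

/-! ## §7 Theorem 3.2 (3.48) at `U = 1` for `C_□` at the def-Y-compatible weights -/

/-- **THEOREM 3.2 (3.48) AT `U = 1` FOR `C_□ = (Q′G′_□²Q′*)⁻¹` AT THE def-Y-COMPATIBLE WEIGHTS**: `C_□(1)` is the two-sided inverse of the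
(2.87) operator of the cube family at `wCube`, the unique left inverse, and `|C_□(y, y′)/W(y′)| ≤ C·len(y)^{−4}·len(y′)^{−(d+1)}·e^{−(δ₁/2)d(y,y′)}`
— `prop23_multiLevelTorus` at `(cubeFam, wCube, cCube)`. [cite: Balaban1985BackgroundPropagators, Thm 3.2 (3.48) p.398 with Cor. 3.5 p.407 and p.409 l.1–5; Balaban1984PropagatorsII, Prop. 2.3 (2.87) p.238] -/
theorem thm32_cubeW_flat (d ℓ : ℕ) (hℓ : 1 ≤ ℓ) :
    ∃ δ₁ C M₀ : ℝ, 0 < δ₁ ∧ 0 < C ∧ 0 < M₀ ∧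
      ∀ {Mh k R : ℕ} {P : Fin (d + 1) → ℕ} (D : B6MultiLevelTorusOperator.TDomains d ℓ Mh k P R)
        (q : ↥(cubes D.toDomains)) (hL : Odd (ℓ + 1)) (hM : Odd Mh) (hMh : 1 ≤ Mh) (hP : ∀ μ, 1 ≤ P μ)
        (_hP4 : ∀ μ, 4 ≤ P μ) (_hR : 2 * (ℓ + 1) ≤ R), M₀ ≤ ((ℓ : ℝ) + 1) * Mh →
        CinvCubeW D q hL hM hMh hP *
            kerOp (W (cubeFam D q hL hM hMh hP).toDomains) (XkT (cubeFam D q hL hM hMh hP) (wCube ℓ)) = 1 ∧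
        kerOp (W (cubeFam D q hL hM hMh hP).toDomains) (XkT (cubeFam D q hL hM hMh hP) (wCube ℓ)) *
            CinvCubeW D q hL hM hMh hP = 1 ∧
        (∀ G' : Module.End ℝ (↥(bset (cubeFam D q hL hM hMh hP).toDomains) → ℝ),
          G' * kerOp (W (cubeFam D q hL hM hMh hP).toDomains) (XkT (cubeFam D q hL hM hMh hP) (wCube ℓ)) = 1 →
            G' = CinvCubeW D q hL hM hMh hP) ∧
        ∀ y y' : ↥(bset (cubeFam D q hL hM hMh hP).toDomains),
          |mat (CinvCubeW D q hL hM hMh hP) y y' / W (cubeFam D q hL hM hMh hP).toDomains y'| ≤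
            C * (geomT (cubeFam D q hL hM hMh hP)).len y ^ (-(4 : ℝ)) *
              (geomT (cubeFam D q hL hM hMh hP)).len y' ^ (-((d + 1 : ℕ) : ℝ)) *
              Real.exp (-(δ₁ / 2 * (geomT (cubeFam D q hL hM hMh hP)).dist y y')) := by
  obtain ⟨δ₁, C, M₀, hδ₁, hC, hM₀, h⟩ :=
    prop23_multiLevelTorus d ℓ hℓ (1 - ((((ℓ : ℝ) + 1)) ^ 2)⁻¹) 1 1 (1 - ((((ℓ : ℝ) + 1)) ^ 2)⁻¹)⁻¹ (amin_pos hℓ) one_pos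
  refine ⟨δ₁, C, M₀, hδ₁, hC, hM₀, ?_⟩
  intro Mh k R P D q hL hM hMh hP hP4 hR hMle
  exact h k Mh R hMle hR P hP hP4 (cubeFam D q hL hM hMh hP) (wCube ℓ) (cCube ℓ) (wCube_window hℓ) (cCube_window hℓ)
    (wCube_rec hℓ)

end Literature.MathematicalPhysics.QuantumFieldTheory.Balaban1983to89.B9Thm31CubeLocalFlat
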